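/-
Copyright: the b2b-balaban T⁴-continuum CRUX team, row NE7b OWNER lineage `t4-ne7b-p1` (gen 139). Project licence.
-/
import Summits.QuantumFields.BalabanUV.T4Continuum.Spine.NE7b.SupExpFamilyDerivative
import Mathlib.Analysis.SpecialFunctions.Gaussian.GaussianIntegral
import Mathlib.MeasureTheory.Integral.IntegralEqImproper
import Mathlib.MeasureTheory.Integral.Prod
import Mathlib.Analysis.Calculus.Deriv.MeanValue

/-!
# THE ONE-SITE GIBBS LETTERS — the one-dimensional half of Dobrushin's covariance estimate (SCOPING (d10)(2)): for a `C¹` potential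
# `w` on `ℝ` whose derivative has FLOOR `c > 0` and CEILING `Cw` in secant form (`c(s−t)² ≤ (w′(s)−w′(t))(s−t)`, `|w′(s)−w′(t)| ≤ Cw|s−t|` —
# the first-order letters of `c ≤ w″ ≤ Cw`), the one-site Gibbs weight `e^{−w}`
#   (i) lies under a Gaussian: `w(s) ≥ w(0) + w′(0)s + (c∕2)s²`, so `e^{−w}·e^{K|s|}` is integrable for every `K` (all exponential moments);
#   (ii) has VARIANCE AT MOST `1∕c`: `(∫s²e^{−w})(∫e^{−w}) − (∫se^{−w})² ≤ (∫e^{−w})²∕c` (integration by parts against `(s−m)e^{−w}`: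
#        `c∫(s−m)²e^{−w} ≤ ∫(s−m)(w′(s)−w′(m))e^{−w} = ∫e^{−w}` — Brascamp–Lieb in one dimension for the linear observable);
#   (iii) DUPLICATION: for `h` `L`-Lipschitz and `k` `κ`-Lipschitz, `|(∫hke^{−w})(∫e^{−w}) − (∫he^{−w})(∫ke^{−w})| ≤ Lκ·[(∫s²e^{−w})(∫e^{−w}) −
#        (∫se^{−w})²]` (`Cov(h,k) = ½E⊗E[(h(s)−h(t))(k(s)−k(t))]` and `|(h(s)−h(t))(k(s)−k(t))| ≤ Lκ(s−t)²`)
# — hence `|Cov_w(h,k)| ≤ Lκ∕c`, the one-step covariance loss of the Gibbs sampler and the source of its Lipschitz propagation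
# (row NE7b, node U5c; (328) BY NAME; [folklore])

Cell `pub-balaban`, sub-cell `t4`, spine estimate NE7b (`T4WeightBudget.RelWeightBound`; the cell's OWN estimate — NOT PRINTED in
[Bałaban 1983–89], NOT PROVED).  Crux-route work under `Spine/NE7b/` by the row OWNER (`t4-ne7b-p1` gen 139, file (443)) under FREEZE
(0)'s crux-prover clause; NOTHING of Bałaban's is named as a Lean object, valued or asserted; no `T4Continuum/Support` leaf typed; no
`def`, no notation; zero `sorry`.  Imports: (328) `…SupExpFamilyDerivative` (`abs_le_exp_abs`) and Mathlib (`integrable_exp_neg_mul_sq`, …).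

WHY (located, SCOPING-d10 (2)).  The conditional law of one coordinate `ω_x` of the road's tilted law, given the others, is the one-site
Gibbs law `e^{−w}ds∕∫e^{−w}` with `w(s) = V(ω^{x,s})`, `V = ½ω·Γ⁻¹ω + U(ω+ψ)`: its derivative has floor `c_x = (Γ⁻¹)_{xx} − κ` and a ceiling
(bounded `U″`).  (442)'s hypotheses (P1)∕(P3) on the Gibbs sampler reduce to two facts about this law: its variance is `≤ 1∕c_x` and the
covariance of two Lipschitz observables is at most `Lκ` times that variance.  Both are typed here, once, for an abstract `w`.

WHAT IS PROVED ([folklore]; `w w′ : ℝ → ℝ`, `hw : HasDerivAt w (w′ s) s`, floor `hmono`, ceiling `hlip`):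
* §1 `quad_lower` (`w 0 + w′ 0·s + (c∕2)s² ≤ w s`), `w_continuous`, `deriv_linear` (`|w′ s| ≤ |w′ 0| + Cw|s|`).
* §2 letters: **`integrable_exp_neg_mul_exp_abs`** (`e^{−w}e^{K|s|} ∈ L¹` for every `K`), `integrable_of_le_exp` (any measurable `f` with
  `|f| ≤ Me^{K|s|}`), `sq_le_exp`, `lip_bound` (`|h s| ≤ (|h 0| + L)e^{|s|}`), `integral_exp_neg_pos` (`0 < ∫e^{−w}`).
* §3 **`variance_raw_le`** (`(∫s²e^{−w})(∫e^{−w}) − (∫se^{−w})² ≤ (∫e^{−w})²∕c`).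
* §4 **`cov_raw_abs_le`** (duplication: `|(∫hke^{−w})(∫e^{−w}) − (∫he^{−w})(∫ke^{−w})| ≤ Lκ[(∫s²e^{−w})(∫e^{−w}) − (∫se^{−w})²]`),
  **`cov_raw_abs_le_floor`** (`… ≤ Lκ(∫e^{−w})²∕c`).
* §5 toy (kernel): `w′ = id` (`w = s²∕2`): the floor with `c = 1` and the ceiling with `Cw = 1`.

HONEST (what this is NOT).  One-dimensional letters only; the Lipschitz dependence of the Gibbs mean on the potential (the other half of
(P1)) is (444); the sampler on `ℝ^ι` and its invariance (445)–(446); the road instance (447).  Scalar skeleton ((A3), NC-NE7b-α UNRULED);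
nothing of Bałaban's asserted.  BY-NAME EFFECT ON THE WALL: NONE.  NE7b NOT PRINTED ∕ NOT PROVED; spine PROVED 0∕9; rung (B)+1 — the
programme's measures remain FINITE-torus statements; NOT the mass gap, NOT Clay.  HONEST DEPENDENCY: continuum YM on T⁴ ⇐ BetaPertH ∧ nine
spine estimates (0∕9 proved); BetaPertH ⇐ (D1) ∧ (D4) ∧ CAP+tail; G-an2-4 gates asym, D1 and NE2∕3∕4.
-/

set_option autoImplicit false

noncomputable section

namespace Summit.QuantumFields.BalabanUV.T4Continuum.NE7b.SupOneSiteGibbsLetters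

open MeasureTheory Real Set
open SupExpFamilyDerivative (abs_le_exp_abs)

variable {w w' : ℝ → ℝ} {c Cw : ℝ}

/-! ## §1. The Gaussian minorant of the potential -/

/-- `w` is continuous. [folklore] -/
theorem w_continuous (hw : ∀ s, HasDerivAt w (w' s) s) : Continuous w :=
  continuous_iff_continuousAt.2 fun s => (hw s).continuousAt

/-- **THE QUADRATIC LOWER BOUND**: a `C¹` potential whose derivative has floor `c` in secant form lies above its osculating parabola at
`0`: `w 0 + w′ 0·s + (c∕2)s² ≤ w s`. [folklore] -/
theorem quad_lower (hw : ∀ s, HasDerivAt w (w' s) s) (hmono : ∀ s t, c * (s - t) ^ 2 ≤ (w' s - w' t) * (s - t)) (s : ℝ) :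
    w 0 + w' 0 * s + c / 2 * s ^ 2 ≤ w s := by
  -- `g(u) = w u − w 0 − w′0·u − (c/2)u²`, `g′(u) = w′u − w′0 − cu`
  have hg : ∀ u, HasDerivAt (fun u => w u - w 0 - w' 0 * u - c / 2 * u ^ 2) (w' u - w' 0 - c * u) u := by
    intro u
    have h2 : HasDerivAt (fun u => w' 0 * u) (w' 0 * 1) u := (hasDerivAt_id u).const_mul (w' 0)
    have hp : HasDerivAt (fun u : ℝ => u ^ 2) (2 * u) u := by simpa using hasDerivAt_pow 2 u
    have h3 : HasDerivAt (fun u => c / 2 * u ^ 2) (c / 2 * (2 * u)) u := hp.const_mul (c / 2)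
    exact ((((hw u).sub_const (w 0)).fun_sub h2).fun_sub h3).congr_deriv (by ring)
  have hcont : Continuous fun u => w u - w 0 - w' 0 * u - c / 2 * u ^ 2 :=
    continuous_iff_continuousAt.2 fun u => (hg u).continuousAt
  have h0 : (fun u => w u - w 0 - w' 0 * u - c / 2 * u ^ 2) 0 = 0 := by simp
  rcases le_total 0 s with hs | hs
  · have hmon : MonotoneOn (fun u => w u - w 0 - w' 0 * u - c / 2 * u ^ 2) (Ici 0) :=
      monotoneOn_of_hasDerivWithinAt_nonneg (convex_Ici 0) hcont.continuousOn (fun u _ => (hg u).hasDerivWithinAt) fun u hu => by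
        rw [interior_Ici] at hu
        have hu' : 0 < u := hu
        have h := hmono u 0
        rw [sub_zero] at h
        nlinarith
    have h := hmon (self_mem_Ici (a := (0 : ℝ))) (mem_Ici.2 hs) hs
    rw [h0] at h
    simp only at h
    linarith
  · have hant : AntitoneOn (fun u => w u - w 0 - w' 0 * u - c / 2 * u ^ 2) (Iic 0) :=
      antitoneOn_of_hasDerivWithinAt_nonpos (convex_Iic 0) hcont.continuousOn (fun u _ => (hg u).hasDerivWithinAt) fun u hu => by
        rw [interior_Iic] at hu
        have hu' : u < 0 := hu
        have h := hmono u 0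
        rw [sub_zero] at h
        nlinarith
    have h := hant (mem_Iic.2 hs) (self_mem_Iic (a := (0 : ℝ))) hs
    rw [h0] at h
    simp only at h
    linarith

/-- The ceiling in growth form: `|w′ s| ≤ |w′ 0| + Cw·|s|`. [folklore] -/
theorem deriv_linear (hlip : ∀ s t, |w' s - w' t| ≤ Cw * |s - t|) (s : ℝ) : |w' s| ≤ |w' 0| + Cw * |s| := by
  have h := hlip s 0
  rw [sub_zero] at h
  have := abs_sub_abs_le_abs_sub (w' s) (w' 0)
  linarith

/-! ## §2. Exponential-moment letters -/

/-- `s² ≤ e^{2|s|}`. [folklore] -/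
theorem sq_le_exp (s : ℝ) : s ^ 2 ≤ exp (2 * |s|) := by
  have h := abs_le_exp_abs s
  calc s ^ 2 = |s| ^ 2 := (sq_abs s).symm
    _ ≤ (exp |s|) ^ 2 := pow_le_pow_left₀ (abs_nonneg s) h 2
    _ = exp (2 * |s|) := by rw [← exp_nat_mul]; norm_num

/-- A Lipschitz function grows at most linearly, hence under `e^{|s|}`: `|h s| ≤ (|h 0| + L)e^{|s|}`. [folklore] -/
theorem lip_bound {h : ℝ → ℝ} {L : ℝ} (hh : ∀ s t, |h s - h t| ≤ L * |s - t|) (s : ℝ) : |h s| ≤ (|h 0| + L) * exp |s| := by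
  have hL : 0 ≤ L := by
    have := hh 1 0; rw [sub_zero, abs_one, mul_one] at this; exact (abs_nonneg _).trans this
  have h1 := hh s 0
  rw [sub_zero] at h1
  have h2 := abs_sub_abs_le_abs_sub (h s) (h 0)
  have h3 : 1 ≤ exp |s| := one_le_exp (abs_nonneg s)
  have h4 := abs_le_exp_abs s
  nlinarith [abs_nonneg (h 0), abs_nonneg s]

/-- A Lipschitz function is continuous. [folklore] -/
theorem lip_continuous {h : ℝ → ℝ} {L : ℝ} (hh : ∀ s t, |h s - h t| ≤ L * |s - t|) : Continuous h := by
  have hL : 0 ≤ L := by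
    have := hh 1 0; rw [sub_zero, abs_one, mul_one] at this; exact (abs_nonneg _).trans this
  exact (LipschitzWith.of_dist_le_mul fun s t => by
    rw [Real.dist_eq, Real.dist_eq, Real.coe_toNNReal _ hL]; exact hh s t : LipschitzWith (Real.toNNReal L) h).continuous

/-- **ALL EXPONENTIAL MOMENTS**: `s ↦ e^{−w s}·e^{K|s|}` is integrable for every `K` (the Gaussian minorant of `w` with floor `c > 0`
absorbs any exponential: `K|s| − w′0·s ≤ (c∕4)s² + (|w′0|+|K|)²∕c`). [folklore] -/
theorem integrable_exp_neg_mul_exp_abs (hw : ∀ s, HasDerivAt w (w' s) s) (hmono : ∀ s t, c * (s - t) ^ 2 ≤ (w' s - w' t) * (s - t))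
    (hc : 0 < c) (K : ℝ) : Integrable (fun s => exp (-w s) * exp (K * |s|)) := by
  set B : ℝ := |w' 0| + |K| with hB
  have hB0 : 0 ≤ B := add_nonneg (abs_nonneg _) (abs_nonneg _)
  have hmeas : AEStronglyMeasurable (fun s => exp (-w s) * exp (K * |s|)) volume :=
    ((continuous_exp.comp (w_continuous hw).neg).mul (continuous_exp.comp (continuous_const.mul continuous_abs))).aestronglyMeasurable
  refine (((integrable_exp_neg_mul_sq (by positivity : (0 : ℝ) < c / 4)).const_mul (exp (-w 0 + B ^ 2 / c)))).mono' hmeas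
    (ae_of_all _ fun s => ?_)
  rw [norm_mul, Real.norm_of_nonneg (exp_pos _).le, Real.norm_of_nonneg (exp_pos _).le, ← exp_add, ← exp_add]
  refine exp_le_exp.2 ?_
  have hq := quad_lower hw hmono s
  -- `|s|·B ≤ (c/4)s² + B²/c`
  have hkey : |s| * B ≤ c / 4 * s ^ 2 + B ^ 2 / c := by
    have h1 : c * (|s| * B) ≤ c * (c / 4 * s ^ 2 + B ^ 2 / c) := by
      have e : c * (c / 4 * s ^ 2 + B ^ 2 / c) = c ^ 2 / 4 * s ^ 2 + B ^ 2 := by field_simp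
      rw [e]
      nlinarith [sq_nonneg (c * |s| / 2 - B), sq_abs s]
    exact le_of_mul_le_mul_left h1 hc
  have hlin : -(w' 0 * s) + K * |s| ≤ |s| * B := by
    rw [hB, mul_add]
    have h1 : -(w' 0 * s) ≤ |s| * |w' 0| := by
      have := neg_abs_le (w' 0 * s); rw [abs_mul] at this; nlinarith [abs_nonneg s, abs_nonneg (w' 0)]
    have h2 : K * |s| ≤ |s| * |K| := by nlinarith [le_abs_self K, abs_nonneg s]
    linarith
  nlinarith

/-- **Domination letter**: any measurable `f` with `|f s| ≤ M·e^{K|s|}` is integrable against `e^{−w}`. [folklore] -/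
theorem integrable_of_le_exp (hw : ∀ s, HasDerivAt w (w' s) s) (hmono : ∀ s t, c * (s - t) ^ 2 ≤ (w' s - w' t) * (s - t)) (hc : 0 < c)
    {f : ℝ → ℝ} (hf : Measurable f) {M K : ℝ} (hfle : ∀ s, |f s| ≤ M * exp (K * |s|)) :
    Integrable (fun s => f s * exp (-w s)) := by
  refine ((integrable_exp_neg_mul_exp_abs hw hmono hc K).const_mul M).mono'
    (hf.mul (measurable_exp.comp (w_continuous hw).measurable.neg)).aestronglyMeasurable (ae_of_all _ fun s => ?_)
  rw [norm_mul, Real.norm_eq_abs, Real.norm_of_nonneg (exp_pos _).le]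
  calc |f s| * exp (-w s) ≤ M * exp (K * |s|) * exp (-w s) := mul_le_mul_of_nonneg_right (hfle s) (exp_pos _).le
    _ = M * (exp (-w s) * exp (K * |s|)) := by ring

/-- `e^{−w}` is integrable. [folklore] -/
theorem integrable_exp_neg (hw : ∀ s, HasDerivAt w (w' s) s) (hmono : ∀ s t, c * (s - t) ^ 2 ≤ (w' s - w' t) * (s - t)) (hc : 0 < c) :
    Integrable (fun s => exp (-w s)) := by
  have h := integrable_of_le_exp hw hmono hc measurable_const (M := 1) (K := 0) (f := fun _ => (1 : ℝ)) (fun s => by simp)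
  simpa only [one_mul] using h

/-- `0 < ∫e^{−w}`. [folklore] -/
theorem integral_exp_neg_pos (hw : ∀ s, HasDerivAt w (w' s) s) (hmono : ∀ s t, c * (s - t) ^ 2 ≤ (w' s - w' t) * (s - t)) (hc : 0 < c) :
    0 < ∫ s, exp (-w s) :=
  integral_exp_pos (integrable_exp_neg hw hmono hc)

/-- `s·e^{−w}` and `s²·e^{−w}` are integrable. [folklore] -/
theorem integrable_moments (hw : ∀ s, HasDerivAt w (w' s) s) (hmono : ∀ s t, c * (s - t) ^ 2 ≤ (w' s - w' t) * (s - t)) (hc : 0 < c) :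
    Integrable (fun s => s * exp (-w s)) ∧ Integrable (fun s => s ^ 2 * exp (-w s)) :=
  ⟨integrable_of_le_exp hw hmono hc measurable_id (M := 1) (K := 1) fun s => by simpa using abs_le_exp_abs s,
    integrable_of_le_exp hw hmono hc (measurable_id.pow_const 2) (M := 1) (K := 2) fun s => by
      rw [abs_of_nonneg (sq_nonneg s), one_mul]; exact sq_le_exp s⟩

/-! ## §3. The variance of the one-site law is at most `1∕c` -/

/-- **THE VARIANCE LETTER** (one-dimensional Brascamp–Lieb for the linear observable, by integration by parts):
`(∫s²e^{−w})(∫e^{−w}) − (∫se^{−w})² ≤ (∫e^{−w})²∕c`. [folklore] -/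
theorem variance_raw_le (hw : ∀ s, HasDerivAt w (w' s) s) (hmono : ∀ s t, c * (s - t) ^ 2 ≤ (w' s - w' t) * (s - t)) (hc : 0 < c)
    (hlip : ∀ s t, |w' s - w' t| ≤ Cw * |s - t|) :
    (∫ s, s ^ 2 * exp (-w s)) * (∫ s, exp (-w s)) - (∫ s, s * exp (-w s)) ^ 2 ≤ (∫ s, exp (-w s)) ^ 2 / c := by
  have hZ := integral_exp_neg_pos hw hmono hc
  have hI0 := integrable_exp_neg hw hmono hc
  obtain ⟨hI1, hI2⟩ := integrable_moments hw hmono hc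
  set Z : ℝ := ∫ s, exp (-w s) with hZdef
  set I1 : ℝ := ∫ s, s * exp (-w s) with hI1def
  set I2 : ℝ := ∫ s, s ^ 2 * exp (-w s) with hI2def
  set m : ℝ := I1 / Z with hm
  have hCw : 0 ≤ Cw := by
    have := hlip 1 0; rw [sub_zero, abs_one, mul_one] at this; exact (abs_nonneg _).trans this
  have hwc := w_continuous hw
  have hw'c : Continuous w' := lip_continuous hlip
  -- integrability of the pieces
  have hA : Integrable (fun s => (s - m) * exp (-w s)) :=
    integrable_of_le_exp hw hmono hc (measurable_id.sub_const m) (M := 1 + |m|) (K := 1) fun s => by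
      have h1 := abs_le_exp_abs s
      have h2 : 1 ≤ exp |s| := one_le_exp (abs_nonneg s)
      have h3 := abs_sub (s : ℝ) m
      rw [one_mul]
      nlinarith [abs_nonneg m, abs_nonneg s]
  have hBb : ∀ s, |(s - m) * w' s| ≤ (1 + |m|) * (|w' 0| + Cw) * exp (2 * |s|) := by
    intro s
    have h1 := abs_le_exp_abs s
    have h2 : 1 ≤ exp |s| := one_le_exp (abs_nonneg s)
    have h3 := abs_sub (s : ℝ) m
    have h4 := deriv_linear hlip s
    have e2 : exp (2 * |s|) = exp |s| * exp |s| := by rw [two_mul, exp_add]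
    rw [abs_mul, e2]
    have ha : |s - m| ≤ (1 + |m|) * exp |s| := by nlinarith [abs_nonneg m]
    have hb : |w' s| ≤ (|w' 0| + Cw) * exp |s| := by nlinarith [abs_nonneg (w' 0), abs_nonneg s]
    calc |s - m| * |w' s| ≤ ((1 + |m|) * exp |s|) * ((|w' 0| + Cw) * exp |s|) :=
          mul_le_mul ha hb (abs_nonneg _) (by positivity)
      _ = (1 + |m|) * (|w' 0| + Cw) * (exp |s| * exp |s|) := by ring
  have hB : Integrable (fun s => (s - m) * w' s * exp (-w s)) :=
    integrable_of_le_exp hw hmono hc ((measurable_id.sub_const m).mul hw'c.measurable) hBb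
  -- integration by parts: `F(s) = (s − m)e^{−w s}`, `∫F′ = 0`
  have hF : ∀ s, HasDerivAt (fun s => (s - m) * exp (-w s)) (exp (-w s) - (s - m) * w' s * exp (-w s)) s := by
    intro s
    have h1 : HasDerivAt (fun s => s - m) 1 s := (hasDerivAt_id s).sub_const m
    have h2 : HasDerivAt (fun s => exp (-w s)) (exp (-w s) * (-w' s)) s := (hw s).fun_neg.exp
    exact (h1.fun_mul h2).congr_deriv (by ring)
  have hF' : Integrable (fun s => exp (-w s) - (s - m) * w' s * exp (-w s)) := hI0.sub hB
  have hIBP := integral_eq_zero_of_hasDerivAt_of_integrable hF hF' hA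
  rw [integral_sub hI0 hB] at hIBP
  -- `∫(s−m)w′e^{−w} = Z`
  have hV1 : ∫ s, (s - m) * w' s * exp (-w s) = Z := by linarith
  -- `∫(s−m)e^{−w} = 0`
  have hV0 : ∫ s, (s - m) * exp (-w s) = 0 := by
    have e : ∀ s, (s - m) * exp (-w s) = s * exp (-w s) - m * exp (-w s) := fun s => by ring
    simp_rw [e]
    rw [integral_sub hI1 (hI0.const_mul m), integral_const_mul, hm]
    field_simp
    ring
  -- `c∫(s−m)²e^{−w} ≤ ∫(s−m)(w′s − w′m)e^{−w} = Z`
  have hsq : Integrable (fun s => (s - m) ^ 2 * exp (-w s)) := by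
    have e : ∀ s, (s - m) ^ 2 * exp (-w s) = s ^ 2 * exp (-w s) - 2 * m * (s * exp (-w s)) + m ^ 2 * exp (-w s) := fun s => by ring
    simp_rw [e]
    exact (hI2.sub (hI1.const_mul _)).add (hI0.const_mul _)
  have hV2 : c * ∫ s, (s - m) ^ 2 * exp (-w s) ≤ Z := by
    have hpt : ∀ s, c * ((s - m) ^ 2 * exp (-w s)) ≤ (s - m) * w' s * exp (-w s) - w' m * ((s - m) * exp (-w s)) := by
      intro s
      have h := hmono s m
      have := mul_le_mul_of_nonneg_right h (exp_pos (-w s)).le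
      nlinarith
    calc c * ∫ s, (s - m) ^ 2 * exp (-w s) = ∫ s, c * ((s - m) ^ 2 * exp (-w s)) := (integral_const_mul _ _).symm
      _ ≤ ∫ s, ((s - m) * w' s * exp (-w s) - w' m * ((s - m) * exp (-w s))) :=
          integral_mono (hsq.const_mul c) (hB.sub (hA.const_mul _)) hpt
      _ = Z := by rw [integral_sub hB (hA.const_mul _), integral_const_mul, hV1, hV0]; ring
  -- `∫(s−m)²e^{−w} = I2 − I1²/Z`
  have hV3 : ∫ s, (s - m) ^ 2 * exp (-w s) = I2 - I1 ^ 2 / Z := by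
    have e : ∀ s, (s - m) ^ 2 * exp (-w s) = s ^ 2 * exp (-w s) - 2 * m * (s * exp (-w s)) + m ^ 2 * exp (-w s) := fun s => by ring
    simp_rw [e]
    have hJ : Integrable (fun s => s ^ 2 * exp (-w s) - 2 * m * (s * exp (-w s))) := hI2.sub (hI1.const_mul _)
    rw [integral_add hJ (hI0.const_mul _), integral_sub hI2 (hI1.const_mul _), integral_const_mul, integral_const_mul, hm]
    field_simp
    ring
  rw [hV3] at hV2
  -- `c(I2 − I1²/Z) ≤ Z` ⟹ `I2·Z − I1² ≤ Z²/c`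
  have h1 : c * (I2 * Z - I1 ^ 2) ≤ Z ^ 2 := by
    have := mul_le_mul_of_nonneg_right hV2 hZ.le
    have e : c * (I2 - I1 ^ 2 / Z) * Z = c * (I2 * Z - I1 ^ 2) := by field_simp
    nlinarith
  rw [le_div_iff₀ hc]
  linarith

/-! ## §4. Duplication: the covariance of two Lipschitz observables against the variance -/

/-- **DUPLICATION**: for `h` `L`-Lipschitz and `k` `κ`-Lipschitz,
`|(∫hke^{−w})(∫e^{−w}) − (∫he^{−w})(∫ke^{−w})| ≤ Lκ·[(∫s²e^{−w})(∫e^{−w}) − (∫se^{−w})²]`. [folklore] -/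
theorem cov_raw_abs_le (hw : ∀ s, HasDerivAt w (w' s) s) (hmono : ∀ s t, c * (s - t) ^ 2 ≤ (w' s - w' t) * (s - t)) (hc : 0 < c)
    {h k : ℝ → ℝ} {L κ : ℝ} (hh : ∀ s t, |h s - h t| ≤ L * |s - t|) (hk : ∀ s t, |k s - k t| ≤ κ * |s - t|) :
    |(∫ s, h s * k s * exp (-w s)) * (∫ s, exp (-w s)) - (∫ s, h s * exp (-w s)) * (∫ s, k s * exp (-w s))| ≤
      L * κ * ((∫ s, s ^ 2 * exp (-w s)) * (∫ s, exp (-w s)) - (∫ s, s * exp (-w s)) ^ 2) := by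
  have hhc := lip_continuous hh
  have hkc := lip_continuous hk
  have hI0 := integrable_exp_neg hw hmono hc
  obtain ⟨hI1, hI2⟩ := integrable_moments hw hmono hc
  -- one-variable integrability
  have hIh : Integrable (fun s => h s * exp (-w s)) :=
    integrable_of_le_exp hw hmono hc hhc.measurable (M := |h 0| + L) (K := 1) fun s => by rw [one_mul]; exact lip_bound hh s
  have hIk : Integrable (fun s => k s * exp (-w s)) :=
    integrable_of_le_exp hw hmono hc hkc.measurable (M := |k 0| + κ) (K := 1) fun s => by rw [one_mul]; exact lip_bound hk s
  have hIhk : Integrable (fun s => h s * k s * exp (-w s)) :=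
    integrable_of_le_exp hw hmono hc (hhc.measurable.mul hkc.measurable) (M := (|h 0| + L) * (|k 0| + κ)) (K := 2) fun s => by
      rw [abs_mul, two_mul, exp_add]
      have h1 := lip_bound hh s
      have h2 := lip_bound hk s
      calc |h s| * |k s| ≤ ((|h 0| + L) * exp |s|) * ((|k 0| + κ) * exp |s|) :=
            mul_le_mul h1 h2 (abs_nonneg _) ((abs_nonneg _).trans h1)
        _ = (|h 0| + L) * (|k 0| + κ) * (exp |s| * exp |s|) := by ring
  -- the duplicated integrals
  set μ2 : Measure (ℝ × ℝ) := (volume : Measure ℝ).prod volume with hμ2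
  have hD : ∫ p : ℝ × ℝ, (h p.1 - h p.2) * (k p.1 - k p.2) * (exp (-w p.1) * exp (-w p.2)) ∂μ2 =
      2 * ((∫ s, h s * k s * exp (-w s)) * (∫ s, exp (-w s)) - (∫ s, h s * exp (-w s)) * (∫ s, k s * exp (-w s))) := by
    have e : ∀ p : ℝ × ℝ, (h p.1 - h p.2) * (k p.1 - k p.2) * (exp (-w p.1) * exp (-w p.2)) =
        (h p.1 * k p.1 * exp (-w p.1)) * exp (-w p.2) - (h p.1 * exp (-w p.1)) * (k p.2 * exp (-w p.2)) -
          (k p.1 * exp (-w p.1)) * (h p.2 * exp (-w p.2)) + exp (-w p.1) * (h p.2 * k p.2 * exp (-w p.2)) := fun p => by ring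
    simp_rw [e]
    have i1 : Integrable (fun p : ℝ × ℝ => (h p.1 * k p.1 * exp (-w p.1)) * exp (-w p.2)) μ2 := hIhk.mul_prod hI0
    have i2 : Integrable (fun p : ℝ × ℝ => (h p.1 * exp (-w p.1)) * (k p.2 * exp (-w p.2))) μ2 := hIh.mul_prod hIk
    have i3 : Integrable (fun p : ℝ × ℝ => (k p.1 * exp (-w p.1)) * (h p.2 * exp (-w p.2))) μ2 := hIk.mul_prod hIh
    have i4 : Integrable (fun p : ℝ × ℝ => exp (-w p.1) * (h p.2 * k p.2 * exp (-w p.2))) μ2 := hI0.mul_prod hIhk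
    have i12 : Integrable (fun p : ℝ × ℝ => (h p.1 * k p.1 * exp (-w p.1)) * exp (-w p.2) -
        (h p.1 * exp (-w p.1)) * (k p.2 * exp (-w p.2))) μ2 := i1.sub i2
    have i123 : Integrable (fun p : ℝ × ℝ => (h p.1 * k p.1 * exp (-w p.1)) * exp (-w p.2) -
        (h p.1 * exp (-w p.1)) * (k p.2 * exp (-w p.2)) - (k p.1 * exp (-w p.1)) * (h p.2 * exp (-w p.2))) μ2 := i12.sub i3
    rw [integral_add i123 i4, integral_sub i12 i3, integral_sub i1 i2,
      integral_prod_mul (fun s => h s * k s * exp (-w s)) (fun s => exp (-w s)),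
      integral_prod_mul (fun s => h s * exp (-w s)) (fun s => k s * exp (-w s)),
      integral_prod_mul (fun s => k s * exp (-w s)) (fun s => h s * exp (-w s)),
      integral_prod_mul (fun s => exp (-w s)) (fun s => h s * k s * exp (-w s))]
    ring
  have hD2 : ∫ p : ℝ × ℝ, (p.1 - p.2) ^ 2 * (exp (-w p.1) * exp (-w p.2)) ∂μ2 =
      2 * ((∫ s, s ^ 2 * exp (-w s)) * (∫ s, exp (-w s)) - (∫ s, s * exp (-w s)) ^ 2) := by
    have e : ∀ p : ℝ × ℝ, (p.1 - p.2) ^ 2 * (exp (-w p.1) * exp (-w p.2)) =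
        (p.1 ^ 2 * exp (-w p.1)) * exp (-w p.2) - 2 * ((p.1 * exp (-w p.1)) * (p.2 * exp (-w p.2))) +
          exp (-w p.1) * (p.2 ^ 2 * exp (-w p.2)) := fun p => by ring
    simp_rw [e]
    have i1 : Integrable (fun p : ℝ × ℝ => (p.1 ^ 2 * exp (-w p.1)) * exp (-w p.2)) μ2 := hI2.mul_prod hI0
    have i2 : Integrable (fun p : ℝ × ℝ => (p.1 * exp (-w p.1)) * (p.2 * exp (-w p.2))) μ2 := hI1.mul_prod hI1
    have i3 : Integrable (fun p : ℝ × ℝ => exp (-w p.1) * (p.2 ^ 2 * exp (-w p.2))) μ2 := hI0.mul_prod hI2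
    have i12 : Integrable (fun p : ℝ × ℝ => (p.1 ^ 2 * exp (-w p.1)) * exp (-w p.2) -
        2 * ((p.1 * exp (-w p.1)) * (p.2 * exp (-w p.2)))) μ2 := i1.sub (i2.const_mul 2)
    rw [integral_add i12 i3, integral_sub i1 (i2.const_mul 2), integral_const_mul,
      integral_prod_mul (fun s => s ^ 2 * exp (-w s)) (fun s => exp (-w s)),
      integral_prod_mul (fun s => s * exp (-w s)) (fun s => s * exp (-w s)),
      integral_prod_mul (fun s => exp (-w s)) (fun s => s ^ 2 * exp (-w s))]
    ring
  -- the pointwise bound `|(h s − h t)(k s − k t)| ≤ Lκ(s − t)²`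
  have hpt : ∀ p : ℝ × ℝ, |(h p.1 - h p.2) * (k p.1 - k p.2) * (exp (-w p.1) * exp (-w p.2))| ≤
      L * κ * ((p.1 - p.2) ^ 2 * (exp (-w p.1) * exp (-w p.2))) := by
    intro p
    have hρ : 0 ≤ exp (-w p.1) * exp (-w p.2) := by positivity
    rw [abs_mul, abs_of_nonneg hρ, abs_mul]
    have h1 := hh p.1 p.2
    have h2 := hk p.1 p.2
    have : |h p.1 - h p.2| * |k p.1 - k p.2| ≤ (L * |p.1 - p.2|) * (κ * |p.1 - p.2|) :=
      mul_le_mul h1 h2 (abs_nonneg _) ((abs_nonneg _).trans h1)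
    calc |h p.1 - h p.2| * |k p.1 - k p.2| * (exp (-w p.1) * exp (-w p.2))
        ≤ (L * |p.1 - p.2|) * (κ * |p.1 - p.2|) * (exp (-w p.1) * exp (-w p.2)) := mul_le_mul_of_nonneg_right this hρ
      _ = L * κ * ((p.1 - p.2) ^ 2 * (exp (-w p.1) * exp (-w p.2))) := by rw [← sq_abs (p.1 - p.2)]; ring
  have hint2 : Integrable (fun p : ℝ × ℝ => (p.1 - p.2) ^ 2 * (exp (-w p.1) * exp (-w p.2))) μ2 := by
    have e : ∀ p : ℝ × ℝ, (p.1 - p.2) ^ 2 * (exp (-w p.1) * exp (-w p.2)) =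
        (p.1 ^ 2 * exp (-w p.1)) * exp (-w p.2) - 2 * ((p.1 * exp (-w p.1)) * (p.2 * exp (-w p.2))) +
          exp (-w p.1) * (p.2 ^ 2 * exp (-w p.2)) := fun p => by ring
    simp_rw [e]
    exact ((hI2.mul_prod hI0).sub ((hI1.mul_prod hI1).const_mul 2)).add (hI0.mul_prod hI2)
  have hmain : |∫ p : ℝ × ℝ, (h p.1 - h p.2) * (k p.1 - k p.2) * (exp (-w p.1) * exp (-w p.2)) ∂μ2| ≤
      L * κ * ∫ p : ℝ × ℝ, (p.1 - p.2) ^ 2 * (exp (-w p.1) * exp (-w p.2)) ∂μ2 := by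
    calc |∫ p : ℝ × ℝ, (h p.1 - h p.2) * (k p.1 - k p.2) * (exp (-w p.1) * exp (-w p.2)) ∂μ2|
        ≤ ∫ p : ℝ × ℝ, |(h p.1 - h p.2) * (k p.1 - k p.2) * (exp (-w p.1) * exp (-w p.2))| ∂μ2 := abs_integral_le_integral_abs
      _ ≤ ∫ p : ℝ × ℝ, L * κ * ((p.1 - p.2) ^ 2 * (exp (-w p.1) * exp (-w p.2))) ∂μ2 :=
          integral_mono_of_nonneg (ae_of_all _ fun p => abs_nonneg _) (hint2.const_mul _) (ae_of_all _ hpt)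
      _ = L * κ * ∫ p : ℝ × ℝ, (p.1 - p.2) ^ 2 * (exp (-w p.1) * exp (-w p.2)) ∂μ2 := integral_const_mul _ _
  rw [hD, hD2] at hmain
  rw [abs_mul, abs_two] at hmain
  linarith

/-- **THE ONE-STEP COVARIANCE LOSS**: with the ceiling letter as well, `|(∫hke^{−w})(∫e^{−w}) − (∫he^{−w})(∫ke^{−w})| ≤ Lκ(∫e^{−w})²∕c`,
i.e. `|Cov_w(h,k)| ≤ Lκ∕c` after division by `(∫e^{−w})²` (`L, κ ≥ 0`). [folklore] -/
theorem cov_raw_abs_le_floor (hw : ∀ s, HasDerivAt w (w' s) s) (hmono : ∀ s t, c * (s - t) ^ 2 ≤ (w' s - w' t) * (s - t)) (hc : 0 < c)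
    (hlip : ∀ s t, |w' s - w' t| ≤ Cw * |s - t|) {h k : ℝ → ℝ} {L κ : ℝ} (hh : ∀ s t, |h s - h t| ≤ L * |s - t|)
    (hk : ∀ s t, |k s - k t| ≤ κ * |s - t|) :
    |(∫ s, h s * k s * exp (-w s)) * (∫ s, exp (-w s)) - (∫ s, h s * exp (-w s)) * (∫ s, k s * exp (-w s))| ≤
      L * κ * ((∫ s, exp (-w s)) ^ 2 / c) := by
  have hL : 0 ≤ L := by
    have := hh 1 0; rw [sub_zero, abs_one, mul_one] at this; exact (abs_nonneg _).trans this
  have hκ : 0 ≤ κ := by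
    have := hk 1 0; rw [sub_zero, abs_one, mul_one] at this; exact (abs_nonneg _).trans this
  exact (cov_raw_abs_le hw hmono hc hh hk).trans (mul_le_mul_of_nonneg_left (variance_raw_le hw hmono hc hlip) (mul_nonneg hL hκ))

/-! ## §5. Toy instance (kernel) -/

/-- Toy: for `w′ = id` (the potential `s²∕2`) the floor with `c = 1` and the ceiling with `Cw = 1` hold. -/
example : (∀ s t : ℝ, (1 : ℝ) * (s - t) ^ 2 ≤ (id s - id t) * (s - t)) ∧ (∀ s t : ℝ, |id s - id t| ≤ (1 : ℝ) * |s - t|) :=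
  ⟨fun s t => by simp only [id, one_mul, sq]; exact le_rfl, fun s t => by simp only [id, one_mul]; exact le_rfl⟩

end Summit.QuantumFields.BalabanUV.T4Continuum.NE7b.SupOneSiteGibbsLetters

end
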